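import Literature.Probability.Percolation.ArmSeparationOutMove
import Literature.Probability.Percolation.ArmSeparationSlotArith
import HarnessLib

/-!
# Slots of the outer landing step: parameters, routing and events

Topic: Probability / Percolation; family `crit-perc`. A brick of the discharge of
`Literature.Probability.Percolation.Nolin2008_twoArm_separation` (Nolin 2008, Thm. 11
[arXiv 0711.4948: Thm. 10], `j = 2`, `σ = BW`; `ArmSeparation.lean`), landing step of the EXTERNAL
extremities (Nolin 2008, §4.4, p. 12, and Prop. 12 (iii)–(i) [arXiv Prop. 11]: "there exists some
landing sequence … where the probability of landing is comparable to the probability of just being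
well-separated"; the sum over the finitely many positions of the tips is the constant `C₁(η')`).
This is the outward twin of `ArmSeparationSlotDefs.lean`: a pair of fenced outer arms with middle
tips (`TrapFencedArm` of `ArmSeparationOuter.lean` read in the axis-compatible frames, the open one
in `frameConfig io ω`, the closed one in `(frameConfig ic ω)ᶜ`) is decomposed according to the
**slot** of the two tips — side, scale index and window index of the tip rows (the `Slot` of
`ArmSeparationSlotDefs.lean`) — and to each slot are attached the **corridor events** of the two
outer landing moves (`out_landing_move`, `out_white_landing_move`): beacon, outer spoke, an arc of a
thin ring OUTSIDE `Λ_{2M}` (radius `r_B ≈ 2M + μ` for the open arm, `r_W ≈ 2M + 3μ` for the closed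
one, `μ = k₀ 32^K`), the approach tube out to `∂Λ_{4M}` and the target free space there, with the
routing that keeps the two colours apart: the target row of each colour avoids the other tip when
that tip sits on the target's side (`Slot.obo`, `Slot.obc`), the arc of the open arm omits the
window of ring `B` met by the closed spoke (`Slot.oloB/ohiB`), and the arc of the closed arm omits
the window of ring `W` met by the open approach tube (`Slot.oloW/ohiW`).

* `OParams` and its derived quantities; `Slot.oko`, …, the routing functions;
* `obcnEvent`, `ocorrEvent`, `Slot.oblackCorr`, `Slot.owhiteCorr`, `Slot.oblackArm`, `Slot.owhiteArm`;
* `exists_owindow`, `subset_iUnion_oslot` — the slots cover every pair of fenced outer arms with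
  middle tips.

## References

* P. Nolin, *Near-critical percolation in two dimensions*, Electron. J. Probab. 13 (2008), §4.2
  Def. 6–8, §4.3 Prop. 12, §4.4 [arXiv 0711.4948: Def. 6–8, Prop. 11, Thm. 10, p. 12]. [Nolin2008]
* H. Kesten, *Scaling relations for 2D-percolation*, Comm. Math. Phys. 109 (1987), Lemma 2, §2. [Kesten1987]
-/

noncomputable section

open Set

namespace Literature.Probability.Percolation

open LatticeModels Tube

/-! ### Parameters of an outer rung -/

/-- **The parameters of one rung of the outer landing step**: current half-radius `M` (the tips sit
on `∂Λ_{2M}`, the targets on `∂Λ_{4M}`), inner radius `n` of the arms, smallest fence scale `k₀`,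
number of scales `K`, tip margin `R₀`. [cite: Nolin2008, §4.4 (arXiv 0711.4948: Thm. 10, external extremities)] -/
structure OParams where
  /-- current half-radius -/
  M : ℕ
  /-- inner radius of the arms -/
  n : ℕ
  /-- smallest fence scale -/
  k₀ : ℕ
  /-- number of fence scales -/
  K : ℕ
  /-- margin of the tips from the corners -/
  R₀ : ℕ

namespace OParams

variable (P : OParams)

/-- window width `w = k₀ / 4` [folklore] -/
def w : ℕ := P.k₀ / 4
/-- spoke half-width `ε = k₀ / 16` [folklore] -/
def ε : ℕ := P.k₀ / 16
/-- ring tube half-width `e = k₀ / 4` [folklore] -/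
def e : ℕ := P.k₀ / 4
/-- ring chunk length `s = k₀` [folklore] -/
def s : ℕ := P.k₀
/-- depth unit `μ = k₀ 32^K` (exceeds `32 k` for every fence scale `k`) [folklore] -/
def μ : ℕ := trapScale P.k₀ P.K
/-- radius of the ring of the open arm, a multiple of `s` in `(2M + μ, 2M + μ + s]` [folklore] -/
def rB : ℕ := P.s * ((2 * P.M + P.μ) / P.s) + P.s
/-- radius of the ring of the closed arm, a multiple of `s` in `(2M + 3μ, 2M + 3μ + s]` [folklore] -/
def rW : ℕ := P.s * ((2 * P.M + 3 * P.μ) / P.s) + P.s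
/-- length of the spoke of the open arm [folklore] -/
def LB : ℕ := P.μ + 2 * P.s + 4 * P.e
/-- length of the spoke of the closed arm [folklore] -/
def LW : ℕ := 3 * P.μ + 2 * P.s + 4 * P.e
/-- target radius `N' = 4M` [folklore] -/
def N' : ℕ := 4 * P.M
/-- width of the approach tube of the open arm: `rB - 2e + WB = N' + N'/16` [folklore] -/
def WB : ℕ := P.N' + P.N' / 16 + 2 * P.e - P.rB
/-- width of the approach tube of the closed arm [folklore] -/
def WW : ℕ := P.N' + P.N' / 16 + 2 * P.e - P.rW
/-- chunks per side of the ring of the open arm [folklore] -/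
def nB : ℕ := P.rB / P.s
/-- chunks per side of the ring of the closed arm [folklore] -/
def nW : ℕ := P.rW / P.s
/-- number of windows of tip rows [folklore] -/
def Nw : ℕ := 2 * P.M / P.w + 1
/-- start of the `ν`-th window [folklore] -/
def T₀ (ν : ℕ) : ℤ := -(2 * (P.M : ℤ)) + ν * P.w
/-- pieces in an exit run: `d s ≥ N'/64 + 2s` [folklore] -/
def d : ℕ := P.N' / 64 / P.s + 3
/-- length of the arc of the open arm: the ring of the open arm minus a window of six tubes [folklore] -/
def lenB : ℕ := 12 * P.nB - 4 - 6

end OParams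

/-! ### Routing -/

namespace Slot

variable (P : OParams) (σ : Slot)

/-- scale of the open tip [folklore] -/
def oko : ℕ := trapScale P.k₀ σ.jo
/-- scale of the closed tip [folklore] -/
def okc : ℕ := trapScale P.k₀ σ.jc
/-- window start of the open tip [folklore] -/
def oTo : ℤ := P.T₀ σ.no
/-- window start of the closed tip [folklore] -/
def oTc : ℤ := P.T₀ σ.nc
/-- lateral position of the beacon and spoke of the open tip (in its frame) [folklore] -/
def oξo : ℤ := σ.oTo P + 2 * σ.oko P + P.w
/-- lateral position of the beacon and spoke of the closed tip (in its frame) [folklore] -/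
def oξc : ℤ := σ.oTc P + 2 * σ.okc P + P.w

/-- **The danger zone** of the upper target row `t = otgtRow N' true`: the lateral positions
`[t - μ - 8s, t + N'/64 + μ + 8s]` on the target's side; if the beacon of the other colour's tip sits
there (so that its slot box, spoke or ring window could meet the approach tube or the exit run), the
lower target row is used instead. [folklore] -/
def ODanger (ξ : ℤ) : Prop :=
  otgtRow P.N' true - P.μ - 8 * P.s ≤ ξ ∧ ξ ≤ otgtRow P.N' true + (P.N' / 64 : ℕ) + P.μ + 8 * P.s

/-- The danger zone is decidable. [folklore] -/
instance (ξ : ℤ) : Decidable (ODanger P ξ) := by unfold ODanger; infer_instance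

/-- target row bit of the open arm: the upper row unless the closed tip sits on side `0` in its danger zone [folklore] -/
def obo : Bool := !decide (σ.ic = 0 ∧ ODanger P (σ.oξc P))
/-- target row bit of the closed arm: the upper row unless the open tip sits on side `3` in its danger zone [folklore] -/
def obc : Bool := !decide (σ.io = 3 ∧ ODanger P (σ.oξo P))
/-- target row of the open arm [folklore] -/
def otgo : ℤ := otgtRow P.N' (σ.obo P)
/-- target row of the closed arm (in the colour-exchanged picture) [folklore] -/
def otgc : ℤ := otgtRow P.N' (σ.obc P)

/-- lateral index of the white spoke on ring `B` [folklore] -/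
def oιc : ℕ := latIdx P.s P.rB (σ.oξc P)
/-- the window of ring `B` touched by the white spoke: first position [folklore] -/
def oloB : ℕ := blockOff P.nB σ.ic + (if σ.ic % 3 = 2 then 2 * (P.nB - 2 - σ.oιc P) else 2 * (σ.oιc P - 1))
/-- the window of ring `B`: last position (six tubes) [folklore] -/
def ohiB : ℕ := σ.oloB P + 5
/-- start of the arc of the open arm [folklore] -/
def oaB : ℕ := σ.ohiB P + 1

/-- lateral indices of the window of ring `W` touched by the black approach tube (side `3` of the
colour-exchanged picture): first [folklore] -/
def oyLo : ℕ := latIdx P.s P.rW (σ.otgo P) - 1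
/-- lateral indices of the window of ring `W`: last [folklore] -/
def oyHi : ℕ := latIdx P.s P.rW (σ.otgo P + (P.N' / 64 : ℕ)) + 1
/-- the window of ring `W`: first position [folklore] -/
def oloW : ℕ := blockOff P.nW 3 + 2 * σ.oyLo P
/-- the window of ring `W`: last position [folklore] -/
def ohiW : ℕ := blockOff P.nW 3 + 2 * σ.oyHi P + 1
/-- start of the arc of the closed arm [folklore] -/
def oaW : ℕ := σ.ohiW P + 1
/-- length of the arc of the closed arm [folklore] -/
def olenW : ℕ := 12 * P.nW - 4 - (σ.ohiW P - σ.oloW P + 1)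

/-- first piece of the exit run of the open arm (side `0` of ring `B`) [folklore] -/
def oxo : ℕ := latIdx P.s P.rB (σ.otgo P)
/-- first piece of the exit run of the closed arm (side `0` of ring `W`) [folklore] -/
def oxc : ℕ := latIdx P.s P.rW (σ.otgc P)
/-- position of the entry piece of the open arm in ring `B` [folklore] -/
def ogEo : ℕ := piecePos P.nB σ.io (latIdx P.s P.rB (σ.oξo P))
/-- position of the entry piece of the closed arm in ring `W` [folklore] -/
def ogEc : ℕ := piecePos P.nW σ.ic' (latIdx P.s P.rW (σ.oξc P))

end Slot

/-! ### The four events of a slot -/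

/-- **The beacon event** of an outer tip of the frame `i` at scale `k` in the window `[T₀, T₀ + w)`. [cite: Nolin2008, §4.3 Prop. 12 (proof) (arXiv 0711.4948: Prop. 11)] -/
def obcnEvent (i M k : ℕ) (T₀ : ℤ) (w : ℕ) : Set (SiteConfig (Site 2)) :=
  {χ | frameConfig i χ ∈ triFrameAt (obcnCentre M k T₀ w) (k / 2)}

/-- **The outer corridor of one colour** in the normalised picture: beacon, outer spoke, arc,
approach tube `[r - 2e, N' + N'/16] × [t, t + N'/64]`, target free space on `∂Λ_{N'}`. [cite: Nolin2008, §4.3 Prop. 12 (proof) (arXiv 0711.4948: Prop. 11)] -/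
def ocorrEvent (i M k : ℕ) (T₀ : ℤ) (w L ε r e s a len : ℕ) (t : ℤ) (W N' : ℕ) : Set (SiteConfig (Site 2)) :=
  obcnEvent i M k T₀ w ∩ ospokeEvent i M k T₀ w L ε ∩ eventAll (arc (thinRing r e s) a len) ∩
    triHCross ((r : ℤ) - 2 * e) t W (N' / 64) ∩ otgtV N' t

namespace Slot

variable (P : OParams) (σ : Slot)

/-- **The corridor of the open arm of the slot.** [cite: Nolin2008, §4.3 Prop. 12 (proof) (arXiv 0711.4948: Prop. 11)] -/
def oblackCorr : Set (SiteConfig (Site 2)) :=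
  ocorrEvent σ.io P.M (σ.oko P) (σ.oTo P) P.w P.LB P.ε P.rB P.e P.s (σ.oaB P) P.lenB (σ.otgo P) P.WB P.N'

/-- **The corridor of the closed arm of the slot** (through `negFlip`). [cite: Nolin2008, §4.3 Prop. 12 (proof) (arXiv 0711.4948: Prop. 11)] -/
def owhiteCorr : Set (SiteConfig (Site 2)) :=
  negFlip ⁻¹' ocorrEvent σ.ic' P.M (σ.okc P) (σ.oTc P) P.w P.LW P.ε P.rW P.e P.s (σ.oaW P) (σ.olenW P) (σ.otgc P) P.WW P.N'

/-- **The tiny-fenced open outer arm with tip in the slot**: a fenced outer arm of the frame `io`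
with a middle tip, at scale index `jo`, with tip row in the `no`-th window. [cite: Nolin2008, §4.4 (arXiv 0711.4948: Thm. 10, external extremities)] -/
def oblackArm : Set (SiteConfig (Site 2)) :=
  {ω | ∃ Fo : TrapFencedArm P.M P.n P.k₀ P.K (frameConfig σ.io ω),
    (-(2 * (P.M : ℤ)) + P.R₀ ≤ Fo.z 1 ∧ Fo.z 1 ≤ -(P.R₀ : ℤ)) ∧ Fo.j = σ.jo ∧ σ.oTo P ≤ Fo.z 1 ∧ Fo.z 1 < σ.oTo P + P.w}

/-- **The tiny-fenced closed outer arm with tip in the slot.** [cite: Nolin2008, §4.4 (arXiv 0711.4948: Thm. 10, external extremities)] -/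
def owhiteArm : Set (SiteConfig (Site 2)) :=
  {ω | ∃ Fc : TrapFencedArm P.M P.n P.k₀ P.K (frameConfig σ.ic ω)ᶜ,
    (-(2 * (P.M : ℤ)) + P.R₀ ≤ Fc.z 1 ∧ Fc.z 1 ≤ -(P.R₀ : ℤ)) ∧ Fc.j = σ.jc ∧ σ.oTc P ≤ Fc.z 1 ∧ Fc.z 1 < σ.oTc P + P.w}

end Slot

/-! ### The slots cover the pairs of fenced outer arms -/

/-- The windows cover the tip rows: every `t ∈ [-2M, 0)` lies in the window of index
`⌊(t + 2M) / w⌋ < Nw` (`1 ≤ w`). [folklore] -/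
theorem exists_owindow (P : OParams) (hw : 1 ≤ P.w) {t : ℤ} (ht : -(2 * (P.M : ℤ)) ≤ t) (ht0 : t < 0) :
    ∃ ν, ν < P.Nw ∧ P.T₀ ν ≤ t ∧ t < P.T₀ ν + P.w := by
  have h0 : (((t + 2 * P.M).toNat : ℕ) : ℤ) = t + 2 * P.M := by omega
  have h1 : (((t + 2 * P.M).toNat / P.w : ℕ) : ℤ) * P.w ≤ (t + 2 * P.M).toNat := by exact_mod_cast Nat.div_mul_le_self _ _
  have h2 : (((t + 2 * P.M).toNat : ℕ) : ℤ) < (((t + 2 * P.M).toNat / P.w : ℕ) : ℤ) * P.w + P.w := by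
    exact_mod_cast Nat.lt_div_mul_add hw
  refine ⟨(t + 2 * P.M).toNat / P.w, ?_, ?_, ?_⟩
  · unfold OParams.Nw
    have : (t + 2 * P.M).toNat ≤ 2 * P.M := by omega
    exact Nat.lt_succ_of_le (Nat.div_le_div_right this)
  · unfold OParams.T₀; omega
  · unfold OParams.T₀; omega

/-- **The slots cover the pairs of fenced outer arms with middle tips**: if `ω` carries a fenced
open outer arm in the frame `io < 6` and a fenced closed outer arm in the frame `ic < 6`, both with
middle tips, then `ω ∈ oblackArm σ ∩ owhiteArm σ` for a slot `σ` with `io, ic < 6`, `jo, jc < K`,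
`no, nc < Nw` (`1 ≤ w`, `1 ≤ R₀`). [cite: Nolin2008, §4.4 (arXiv 0711.4948: Thm. 10, external extremities)] -/
theorem subset_iUnion_oslot (P : OParams) (hw : 1 ≤ P.w) (hR : 1 ≤ P.R₀) {ω : SiteConfig (Site 2)} {io ic : ℕ} (hio : io < 6) (hic : ic < 6)
    (Fo : TrapFencedArm P.M P.n P.k₀ P.K (frameConfig io ω)) (hFo : -(2 * (P.M : ℤ)) + P.R₀ ≤ Fo.z 1 ∧ Fo.z 1 ≤ -(P.R₀ : ℤ))
    (Fc : TrapFencedArm P.M P.n P.k₀ P.K (frameConfig ic ω)ᶜ) (hFc : -(2 * (P.M : ℤ)) + P.R₀ ≤ Fc.z 1 ∧ Fc.z 1 ≤ -(P.R₀ : ℤ)) :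
    ω ∈ ⋃ σ ∈ {σ : Slot | σ.io < 6 ∧ σ.jo < P.K ∧ σ.no < P.Nw ∧ σ.ic < 6 ∧ σ.jc < P.K ∧ σ.nc < P.Nw},
      Slot.oblackArm P σ ∩ Slot.owhiteArm P σ := by
  have hto : -(2 * (P.M : ℤ)) ≤ Fo.z 1 ∧ Fo.z 1 < 0 := by constructor <;> omega
  have htc : -(2 * (P.M : ℤ)) ≤ Fc.z 1 ∧ Fc.z 1 < 0 := by constructor <;> omega
  obtain ⟨no, hno, hno1, hno2⟩ := exists_owindow P hw hto.1 hto.2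
  obtain ⟨nc, hnc, hnc1, hnc2⟩ := exists_owindow P hw htc.1 htc.2
  simp only [Set.mem_iUnion, Set.mem_setOf_eq, exists_prop]
  refine ⟨⟨io, Fo.j, no, ic, Fc.j, nc⟩, ⟨hio, Fo.j_lt, hno, hic, Fc.j_lt, hnc⟩, ?_, ?_⟩
  · exact ⟨Fo, hFo, rfl, hno1, hno2⟩
  · exact ⟨Fc, hFc, rfl, hnc1, hnc2⟩

end Literature.Probability.Percolation
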